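import Mathlib.Topology.MetricSpace.HausdorffDistance
import Mathlib.Analysis.InnerProductSpace.EuclideanDist
import Literature.Analysis.PDE.HopfLemmas
import Literature.Analysis.PDE.HopfBarrier
import HarnessLib

/-!
# E. Hopf's minimum principle (López-Gómez 2012, Ch. 1, Thm. 1.2)

The strong minimum principle of E. Hopf for linear second order elliptic operators
`𝔏 = -∑ᵢⱼ aᵢⱼ(x) ∂ᵢⱼ + ∑ᵢ bᵢ(x) ∂ᵢ + c(x)` with `c ≥ 0`, **proved** following López-Gómez,
*Linear Second Order Elliptic Operators* (2012), Ch. 1, Thm. 1.2, from the two pointwise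
ingredients already in the tree: the classical minimum principle at a point
(`linearOp_nonpos_at_isLocalMin`, Thm. 1.1, `HopfLemmas.lean`) and the computation of `𝔏` on the
bump `e^{-α|x-z|²}` with the negativity of its bracket for large `α`
(`linearOp_hopfBump`, `hopfBracket_le_neg_one`, (1.19)–(1.20), `HopfBarrier.lean`).

* `norm_sub_lt_of_norm_sub_midpoint_le` — strict convexity of balls in a real inner product
  space: the closed ball centred at the midpoint `z` of `y₁y₂` through `y₂` lies in the open ball
  `B_{|y₂-y₁|}(y₁)` except for `y₂` ((1.14));
* `linearOp_jet_sub_smul` — the pointwise operator is linear in the jet;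
* `hopf_lt_at_touchingPoint` — **the touching-ball step** of the proof ((1.13)–(1.22)): if
  `u ∈ C²(Ω)` is superharmonic (`𝔏u ≥ 0`) with `u ≥ m`, `m ≤ 0`, and `u > m` in an open ball
  `B_ρ(y₁)`, then `u > m` at every point `y₂` with `|y₂ - y₁| = ρ` and `B̄_{ρ/4}(y₂) ⊆ Ω`
  (comparison with `w = u - ε(e^{-α|x-z|²} - e^{-αρ²/4})` on `B̄_{ρ/4}(y₂)`);
* `hopf_minimumPrinciple_eventually_eq` — **local form** (Remark 1.1(b)): the coincidence set
  `{u = m}` is open (nearest-point argument on the compact set `{u = m} ∩ B̄_R(x⋆)`);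
* `hopf_minimumPrinciple` — **Thm. 1.2**: on a connected open `Ω`, a superharmonic `u ≥ m`,
  `m ≤ 0`, attaining `m` is identically `m`.

Setting and faithfulness. As in (1.1)–(1.2) of the source: `Ω ⊆ ℝᴺ` open (and connected for
Thm. 1.2), `aᵢⱼ = aⱼᵢ`, `𝔏` uniformly elliptic in `Ω` (`∑ aᵢⱼ ξᵢ ξⱼ ≥ μ|ξ|²`, one `μ > 0`),
coefficients bounded on compact subsets of `Ω` (the source allows `L^∞_loc` coefficients and
pointwise inequalities; here the coefficients are arbitrary functions bounded on compacts and
`𝔏u ≥ 0` is required at every point of `Ω`, which is the same thing for the pointwise-defined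
operator), `c ≥ 0`, `u ∈ C²(Ω)` (`ContDiffOn ℝ 2 u Ω`). The source takes `m = inf_Ω u ∈ (-∞, 0]`;
we take any constant `m ≤ 0` with `u ≥ m` attained at a point, which is equivalent. Partial
derivatives are Fréchet derivatives along `eᵢ = EuclideanSpace.single i 1`:
`∂ᵢu(x) = Du(x) eᵢ`, `∂ᵢⱼu(x) = D(Du)(x) eᵢ eⱼ`, exactly as in `HopfLemmas.lean`.

Not here: the boundary lemma (Thm. 1.3) and the generalized minimum principle (Thm. 1.7).
Downstream: Alexandrov's tangency maximum principle for `C¹` elliptic jet operators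
(`Literature/Geometry/Lorentzian/TangencyMaximumPrinciple.lean`), hence the maximum principle
for minimal graphs.

## References

* J. López-Gómez, *Linear Second Order Elliptic Operators*, World Scientific (2012; © 2013),
  Ch. 1: (1.1)–(1.2), Thm. 1.1, Thm. 1.2 and its proof ((1.9)–(1.22)), Remark 1.1(b).
* E. Hopf, *Elementare Bemerkungen über die Lösungen partieller Differentialgleichungen zweiter
  Ordnung vom elliptischen Typus*, Sitzungsber. Preuss. Akad. Wiss. 19 (1927) 147–152.
* D. Gilbarg, N. S. Trudinger, *Elliptic Partial Differential Equations of Second Order*,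
  Springer 2001, Lemma 3.4 and Thm. 3.5.
-/

noncomputable section

open Set Filter Metric
open scoped Topology RealInnerProductSpace

namespace Literature.Analysis.PDE

/-! ### Strict convexity of Euclidean balls -/

/-- **The tangent ball at `y₂`.** In a real inner product space let `z` be the midpoint of
`y₁` and `y₂`. If `‖x - z‖ ≤ ‖y₂ - z‖` and `x ≠ y₂`, then `‖x - y₁‖ < ‖y₂ - y₁‖`: the closed ball
centred at the midpoint through `y₂` lies in the open ball centred at `y₁` through `y₂`, except
for the point `y₂` itself (López-Gómez 2012, (1.14)). [folklore] -/
theorem norm_sub_lt_of_norm_sub_midpoint_le {V : Type*} [NormedAddCommGroup V]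
    [InnerProductSpace ℝ V] {y₁ y₂ x : V}
    (hx : ‖x - (2⁻¹ : ℝ) • (y₁ + y₂)‖ ≤ ‖y₂ - (2⁻¹ : ℝ) • (y₁ + y₂)‖) (hne : x ≠ y₂) :
    ‖x - y₁‖ < ‖y₂ - y₁‖ := by
  set z : V := (2⁻¹ : ℝ) • (y₁ + y₂) with hz
  set d : V := x - z with hd
  set e : V := y₂ - z with he
  have he' : z - y₁ = e := by
    simp only [he, hz, smul_add]; module
  have hxy : x - y₁ = d + e := by rw [← he', hd]; abel
  have hy : y₂ - y₁ = e + e := by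
    rw [show y₂ - y₁ = (y₂ - z) + (z - y₁) by abel, he']
  have hde : d ≠ e := by
    intro h
    apply hne
    have : x - z = y₂ - z := by rw [← hd, ← he, h]
    simpa using this
  have hpos : 0 < ‖d - e‖ ^ 2 := by
    have : d - e ≠ 0 := sub_ne_zero.mpr hde
    positivity
  have h1 : ‖d - e‖ ^ 2 = ‖d‖ ^ 2 - 2 * ⟪d, e⟫ + ‖e‖ ^ 2 := norm_sub_sq_real d e
  have h2 : ‖d + e‖ ^ 2 = ‖d‖ ^ 2 + 2 * ⟪d, e⟫ + ‖e‖ ^ 2 := norm_add_sq_real d e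
  have h3 : ‖d‖ ≤ ‖e‖ := hx
  have h4 : ‖d + e‖ ^ 2 < (‖e‖ + ‖e‖) ^ 2 := by
    nlinarith [norm_nonneg d, norm_nonneg e]
  have h5 : ‖e + e‖ = ‖e‖ + ‖e‖ := by
    rw [← two_smul ℝ e, norm_smul, Real.norm_two, two_mul]
  rw [hxy, hy, h5]
  exact lt_of_pow_lt_pow_left₀ 2 (by positivity) h4

/-! ### Linearity of the operator in the function -/

variable {N : ℕ}

/-- The pointwise operator `-∑ aᵢⱼ Uᵢⱼ + ∑ bᵢ U'ᵢ + c u` is linear in the jet `(Uᵢⱼ, U'ᵢ, u)`: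
its value on `U - ε V` is its value on `U` minus `ε` times its value on `V`. [folklore] -/
theorem linearOp_jet_sub_smul (a : Fin N → Fin N → ℝ) (b : Fin N → ℝ) (c ε : ℝ)
    (U V : Fin N → Fin N → ℝ) (U' V' : Fin N → ℝ) (u v : ℝ) :
    -(∑ i, ∑ j, a i j * (U i j - ε * V i j)) + ∑ i, b i * (U' i - ε * V' i) + c * (u - ε * v) =
      (-(∑ i, ∑ j, a i j * U i j) + ∑ i, b i * U' i + c * u) -
        ε * (-(∑ i, ∑ j, a i j * V i j) + ∑ i, b i * V' i + c * v) := by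
  simp only [mul_sub, Finset.sum_sub_distrib, Finset.mul_sum, mul_add, mul_neg]
  have h1 : ∑ i, ∑ j, a i j * (ε * V i j) = ∑ i, ∑ j, ε * (a i j * V i j) :=
    Finset.sum_congr rfl fun i _ ↦ Finset.sum_congr rfl fun j _ ↦ by ring
  have h2 : ∑ i, b i * (ε * V' i) = ∑ i, ε * (b i * V' i) :=
    Finset.sum_congr rfl fun i _ ↦ by ring
  rw [h1, h2]
  ring

/-! ### The touching-ball step of E. Hopf's proof -/

/-- The bump is at most `1` for `α ≥ 0`. [folklore] -/
lemma hopfBump_le_one {α : ℝ} (hα : 0 ≤ α) (z x : EuclideanSpace ℝ (Fin N)) :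
    hopfBump α z x ≤ 1 := by
  unfold hopfBump
  rw [Real.exp_le_one_iff]
  nlinarith [sq_nonneg ‖x - z‖]

/-- **The touching-ball step in E. Hopf's proof of the minimum principle** (López-Gómez 2012,
proof of Thm. 1.2, (1.13)–(1.22)). Let `𝔏 = -∑ aᵢⱼ ∂ᵢⱼ + ∑ bᵢ ∂ᵢ + c` have symmetric, uniformly
elliptic (constant `μ > 0`) coefficients on the open set `Ω ⊆ ℝᴺ`, bounded on compact subsets of
`Ω`, with `c ≥ 0`; let `u ∈ C²(Ω)` be superharmonic, `𝔏u ≥ 0` in `Ω`, with `u ≥ m` in `Ω` for a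
constant `m ≤ 0`. If `u > m` in the open ball `B_ρ(y₁)` and `y₂` is a point at distance `ρ` from
`y₁` with `B̄_{ρ/4}(y₂) ⊆ Ω`, then also `u(y₂) > m`. (Otherwise, with `z` the midpoint of `y₁y₂`,
`v = e^{-α|x-z|²} - e^{-αρ²/4}` and `w = u - εv` for `α` large and `ε > 0` small, `w` has a
non-positive minimum in the open ball `B_{ρ/4}(y₂)` although `𝔏w > 0` there, contradicting the
classical minimum principle, Thm. 1.1.) Partial derivatives are Fréchet derivatives along
`eᵢ = EuclideanSpace.single i 1`, as in `linearOp_nonpos_at_isLocalMin`.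
[cite: LopezGomez2012, Thm. 1.2 (proof, (1.13)–(1.22))] -/
theorem hopf_lt_at_touchingPoint {Ω : Set (EuclideanSpace ℝ (Fin N))} (hΩ : IsOpen Ω)
    {a : EuclideanSpace ℝ (Fin N) → Fin N → Fin N → ℝ} {b : EuclideanSpace ℝ (Fin N) → Fin N → ℝ}
    {c u : EuclideanSpace ℝ (Fin N) → ℝ} {μ m : ℝ}
    (ha_symm : ∀ x ∈ Ω, ∀ i j, a x i j = a x j i) (hμ : 0 < μ)
    (hell : ∀ x ∈ Ω, ∀ ξ : EuclideanSpace ℝ (Fin N), μ * ‖ξ‖ ^ 2 ≤ ∑ i, ∑ j, a x i j * ξ i * ξ j)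
    (hbdd : ∀ K ⊆ Ω, IsCompact K →
      ∃ C, ∀ x ∈ K, (∀ i j, |a x i j| ≤ C) ∧ (∀ i, |b x i| ≤ C) ∧ |c x| ≤ C)
    (hc : ∀ x ∈ Ω, 0 ≤ c x) (hu : ContDiffOn ℝ 2 u Ω)
    (hLu : ∀ x ∈ Ω, 0 ≤ -(∑ i, ∑ j, a x i j * fderiv ℝ (fderiv ℝ u) x (EuclideanSpace.single i 1)
        (EuclideanSpace.single j 1)) +
      ∑ i, b x i * fderiv ℝ u x (EuclideanSpace.single i 1) + c x * u x)
    (hm : m ≤ 0) (hum : ∀ x ∈ Ω, m ≤ u x)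
    {y₁ y₂ : EuclideanSpace ℝ (Fin N)} {ρ : ℝ} (hρ : 0 < ρ) (hy : dist y₂ y₁ = ρ)
    (hball : ∀ x ∈ ball y₁ ρ, m < u x) (hK : closedBall y₂ (ρ / 4) ⊆ Ω) :
    m < u y₂ := by
  have hy₂Ω : y₂ ∈ Ω := hK (mem_closedBall_self (by positivity))
  refine lt_of_le_of_ne (hum y₂ hy₂Ω) fun huy₂ ↦ ?_
  -- `huy₂ : m = u y₂`; the midpoint `z` and the geometry of the two balls
  set z : EuclideanSpace ℝ (Fin N) := (2⁻¹ : ℝ) • (y₁ + y₂) with hz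
  have hy₂z : ‖y₂ - z‖ = ρ / 2 := by
    have : y₂ - z = (2⁻¹ : ℝ) • (y₂ - y₁) := by simp only [hz, smul_sub, smul_add]; module
    rw [this, norm_smul, Real.norm_eq_abs, abs_of_pos (by norm_num : (0 : ℝ) < 2⁻¹),
      ← dist_eq_norm, hy]
    ring
  set K : Set (EuclideanSpace ℝ (Fin N)) := closedBall y₂ (ρ / 4) with hKdef
  have hKc : IsCompact K := isCompact_closedBall _ _
  have hfar : ∀ x ∈ K, ρ / 4 ≤ ‖x - z‖ := fun x hx ↦ by
    have h1 : ‖x - y₂‖ ≤ ρ / 4 := by rw [← dist_eq_norm]; exact mem_closedBall.mp hx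
    have h2 : ‖y₂ - z‖ ≤ ‖y₂ - x‖ + ‖x - z‖ := norm_sub_le_norm_sub_add_norm_sub _ _ _
    rw [norm_sub_rev y₂ x] at h2
    linarith
  have hnear : ∀ x ∈ K, ‖x - z‖ ≤ 3 * ρ / 4 := fun x hx ↦ by
    have h1 : ‖x - y₂‖ ≤ ρ / 4 := by rw [← dist_eq_norm]; exact mem_closedBall.mp hx
    have h2 : ‖x - z‖ ≤ ‖x - y₂‖ + ‖y₂ - z‖ := norm_sub_le_norm_sub_add_norm_sub _ _ _
    linarith
  -- bounds for the coefficients on `K`, and the steepness `α`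
  obtain ⟨C, hC⟩ := hbdd K hK hKc
  set C₀ : ℝ := max C 0 with hC₀
  have hC₀nn : 0 ≤ C₀ := le_max_right _ _
  have hCa : ∀ x ∈ K, ∀ i j, |a x i j| ≤ C₀ := fun x hx i j ↦
    ((hC x hx).1 i j).trans (le_max_left _ _)
  have hCb : ∀ x ∈ K, ∀ i, |b x i| ≤ C₀ := fun x hx i ↦ ((hC x hx).2.1 i).trans (le_max_left _ _)
  have hCc : ∀ x ∈ K, c x ≤ C₀ := fun x hx ↦
    ((le_abs_self _).trans (hC x hx).2.2).trans (le_max_left _ _)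
  set α : ℝ := max 1 ((8 * N * C₀ + 8 * N * C₀ * (3 * ρ / 4) + 4 * C₀ + 4) * 4 / (μ * ρ ^ 2))
    with hα
  have hα1 : 1 ≤ α := le_max_left _ _
  have hα0 : 0 < α := by linarith
  -- the comparison function `v` and `𝔏v < 0` on `K`
  set v : EuclideanSpace ℝ (Fin N) → ℝ := fun x ↦ hopfBump α z x - Real.exp (-α * (ρ / 2) ^ 2)
    with hv
  have hdv : fderiv ℝ v = fderiv ℝ (hopfBump α z) := by
    funext x; simp only [hv]; exact fderiv_sub_const _
  have hvdiff : Differentiable ℝ v := fun x ↦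
    ((contDiff_hopfBump α z (n := 1)).differentiable one_ne_zero x).sub_const _
  have hvC2 : ContDiff ℝ 2 v := (contDiff_hopfBump α z).sub contDiff_const
  have hLv : ∀ x ∈ K, -(∑ i, ∑ j, a x i j * fderiv ℝ (fderiv ℝ v) x (EuclideanSpace.single i 1)
        (EuclideanSpace.single j 1)) +
      ∑ i, b x i * fderiv ℝ v x (EuclideanSpace.single i 1) + c x * v x < 0 := by
    intro x hx
    have hxΩ : x ∈ Ω := hK hx
    have hbr := hopfBracket_le_neg_one (x := x) (z := z) (a := a x) (b := b x) (c := c x) hμ hρ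
      hC₀nn (hell x hxΩ) (hCa x hx) (hCb x hx) (hCc x hx) (hfar x hx) (hnear x hx)
      (le_of_eq hα.symm)
    have hop := linearOp_hopfBump α z x (a x) (b x) (c x)
    rw [hdv]
    have hsplit : c x * v x = c x * hopfBump α z x - c x * Real.exp (-α * (ρ / 2) ^ 2) := by
      simp only [hv]; ring
    rw [hsplit]
    have hexp : 0 ≤ c x * Real.exp (-α * (ρ / 2) ^ 2) :=
      mul_nonneg (hc x hxΩ) (Real.exp_pos _).le
    have hb0 := hopfBump_pos α z x
    have : hopfBump α z x * (-4 * α ^ 2 * ∑ i, ∑ j, a x i j * (x i - z i) * (x j - z j) +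
        2 * α * ∑ i, a x i i - 2 * α * ∑ i, b x i * (x i - z i) + c x) ≤
        hopfBump α z x * (-1) :=
      mul_le_mul_of_nonneg_left hbr hb0.le
    linarith
  -- signs of `v`: `v < 1`, `v(y₂) = 0`, `v < 0` outside `B̄_{ρ/2}(z)`
  have hv1 : ∀ x, v x < 1 := fun x ↦ by
    simp only [hv]
    linarith [hopfBump_le_one hα0.le z x, Real.exp_pos (-α * (ρ / 2) ^ 2)]
  have hvy₂ : v y₂ = 0 := by
    simp only [hv, hopfBump, hy₂z, sub_self]
  have hvneg : ∀ x, ρ / 2 < ‖x - z‖ → v x < 0 := fun x hx ↦ by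
    simp only [hv, hopfBump, sub_neg]
    apply Real.exp_lt_exp.mpr
    have : (ρ / 2) ^ 2 < ‖x - z‖ ^ 2 := by gcongr
    nlinarith
  -- `ξ`: on `S₁ = ∂B_{ρ/4}(y₂) ∩ B̄_{ρ/2}(z)` we have `u ≥ m + ξ`
  set S₁ : Set (EuclideanSpace ℝ (Fin N)) := sphere y₂ (ρ / 4) ∩ closedBall z (ρ / 2) with hS₁
  have hS₁K : S₁ ⊆ K := fun x hx ↦ sphere_subset_closedBall hx.1
  have hS₁gt : ∀ x ∈ S₁, m < u x := by
    intro x hx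
    apply hball
    rw [mem_ball, dist_eq_norm, ← hy, dist_eq_norm]
    apply norm_sub_lt_of_norm_sub_midpoint_le
    · rw [← hz, hy₂z, ← dist_eq_norm]; exact mem_closedBall.mp hx.2
    · intro hxy
      have := hx.1
      rw [hxy, mem_sphere, dist_self] at this
      linarith
  have hucont : ContinuousOn u Ω := hu.continuousOn
  obtain ⟨ξ, hξ, hξS⟩ : ∃ ξ : ℝ, 0 < ξ ∧ ∀ x ∈ S₁, m + ξ ≤ u x := by
    by_cases hne : S₁.Nonempty
    · have hS₁c : IsCompact S₁ := (isCompact_sphere _ _).inter_right isClosed_closedBall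
      obtain ⟨x₀, hx₀, hmin⟩ := hS₁c.exists_isMinOn hne (hucont.mono (hS₁K.trans hK))
      exact ⟨u x₀ - m, by linarith [hS₁gt x₀ hx₀], fun x hx ↦ by
          linarith [show u x₀ ≤ u x from hmin hx]⟩
    · exact ⟨1, one_pos, fun x hx ↦ (hne ⟨x, hx⟩).elim⟩
  -- `w = u - εv` with `ε = ξ/2`: `w(y₂) = m`, `w > m` on the sphere `∂B_{ρ/4}(y₂)`
  set ε : ℝ := ξ / 2 with hε
  have hε0 : 0 < ε := by positivity
  set w : EuclideanSpace ℝ (Fin N) → ℝ := fun x ↦ u x - ε * v x with hw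
  have hwy₂ : w y₂ = m := by simp only [hw, hvy₂, mul_zero, sub_zero, huy₂]
  have hwS : ∀ x ∈ sphere y₂ (ρ / 4), m < w x := by
    intro x hx
    have hxΩ : x ∈ Ω := hK (sphere_subset_closedBall hx)
    simp only [hw]
    by_cases hxz : ‖x - z‖ ≤ ρ / 2
    · have h1 := hξS x ⟨hx, by rwa [mem_closedBall, dist_eq_norm]⟩
      have h2 : ε * v x ≤ ε * 1 := mul_le_mul_of_nonneg_left (hv1 x).le hε0.le
      linarith
    · have h1 := hvneg x (lt_of_not_ge hxz)
      have h2 : ε * v x < 0 := mul_neg_of_pos_of_neg hε0 h1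
      linarith [hum x hxΩ]
  -- the minimum of `w` on `K` is attained in the open ball
  have hwcont : ContinuousOn w K :=
    (hucont.mono hK).sub (continuousOn_const.mul (hvdiff.continuous.continuousOn))
  obtain ⟨x₁, hx₁K, hmin⟩ := hKc.exists_isMinOn ⟨y₂, mem_closedBall_self (by positivity)⟩ hwcont
  have hwx₁ : w x₁ ≤ m := hwy₂ ▸ hmin (mem_closedBall_self (by positivity))
  have hx₁ball : x₁ ∈ ball y₂ (ρ / 4) := by
    have h1 : dist x₁ y₂ ≤ ρ / 4 := mem_closedBall.mp hx₁K
    rcases h1.lt_or_eq with h | h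
    · exact mem_ball.mpr h
    · exact absurd hwx₁ (not_le.mpr (hwS x₁ (mem_sphere.mpr h)))
  have hx₁Ω : x₁ ∈ Ω := hK hx₁K
  have hlocmin : IsLocalMin w x₁ := hmin.isLocalMin (closedBall_mem_nhds_of_mem hx₁ball)
  -- regularity of `w` at `x₁` and the value of `𝔏w(x₁)`
  have hΩx₁ : Ω ∈ 𝓝 x₁ := hΩ.mem_nhds hx₁Ω
  have huC2 : ContDiffAt ℝ 2 u x₁ := hu.contDiffAt hΩx₁
  have hwC2 : ContDiffAt ℝ 2 w x₁ := huC2.sub (contDiffAt_const.mul hvC2.contDiffAt)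
  have hdu1 : ∀ x ∈ Ω, DifferentiableAt ℝ u x := fun x hx ↦
    (hu.contDiffAt (hΩ.mem_nhds hx)).differentiableAt two_ne_zero
  have hdu2 : DifferentiableAt ℝ (fderiv ℝ u) x₁ :=
    ((hu.fderiv_of_isOpen hΩ le_rfl).contDiffAt hΩx₁).differentiableAt one_ne_zero
  have hdv2 : DifferentiableAt ℝ (fderiv ℝ v) x₁ := by
    rw [hdv]; exact differentiableAt_fderiv_hopfBump α z x₁
  have hfw : ∀ x ∈ Ω, fderiv ℝ w x = fderiv ℝ u x - ε • fderiv ℝ v x := fun x hx ↦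
    ((hdu1 x hx).hasFDerivAt.sub (((hvdiff x).hasFDerivAt).const_mul ε)).fderiv
  have hfw' : fderiv ℝ w =ᶠ[𝓝 x₁] fun x ↦ fderiv ℝ u x - ε • fderiv ℝ v x :=
    Filter.eventually_of_mem hΩx₁ hfw
  have hffw : fderiv ℝ (fderiv ℝ w) x₁ =
      fderiv ℝ (fderiv ℝ u) x₁ - ε • fderiv ℝ (fderiv ℝ v) x₁ := by
    rw [hfw'.fderiv_eq]
    exact (hdu2.hasFDerivAt.sub (hdv2.hasFDerivAt.const_smul ε)).fderiv
  have hLw : -(∑ i, ∑ j, a x₁ i j * fderiv ℝ (fderiv ℝ w) x₁ (EuclideanSpace.single i 1)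
        (EuclideanSpace.single j 1)) +
      ∑ i, b x₁ i * fderiv ℝ w x₁ (EuclideanSpace.single i 1) + c x₁ * w x₁ =
      (-(∑ i, ∑ j, a x₁ i j * fderiv ℝ (fderiv ℝ u) x₁ (EuclideanSpace.single i 1)
        (EuclideanSpace.single j 1)) +
      ∑ i, b x₁ i * fderiv ℝ u x₁ (EuclideanSpace.single i 1) + c x₁ * u x₁) -
      ε * (-(∑ i, ∑ j, a x₁ i j * fderiv ℝ (fderiv ℝ v) x₁ (EuclideanSpace.single i 1)
        (EuclideanSpace.single j 1)) +
      ∑ i, b x₁ i * fderiv ℝ v x₁ (EuclideanSpace.single i 1) + c x₁ * v x₁) := by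
    rw [hffw, hfw x₁ hx₁Ω]
    simp only [sub_apply, smul_apply, smul_eq_mul]
    exact linearOp_jet_sub_smul (a x₁) (b x₁) (c x₁) ε _ _ _ _ (u x₁) (v x₁)
  -- the classical minimum principle at `x₁` versus `𝔏w(x₁) > 0`
  have hpsd : ∀ ξ' : Fin N → ℝ, 0 ≤ ∑ i, ∑ j, a x₁ i j * ξ' i * ξ' j := fun ξ' ↦ by
    have h := hell x₁ hx₁Ω (WithLp.toLp 2 ξ')
    exact le_trans (by positivity) h
  have hle := linearOp_nonpos_at_isLocalMin (b x₁) (ha_symm x₁ hx₁Ω) hpsd (hc x₁ hx₁Ω) hwC2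
    hlocmin (hwx₁.trans hm)
  rw [hLw] at hle
  have h1 := hLu x₁ hx₁Ω
  have h2 := hLv x₁ hx₁K
  have h3 : 0 < -(ε * (-(∑ i, ∑ j, a x₁ i j * fderiv ℝ (fderiv ℝ v) x₁
        (EuclideanSpace.single i 1) (EuclideanSpace.single j 1)) +
      ∑ i, b x₁ i * fderiv ℝ v x₁ (EuclideanSpace.single i 1) + c x₁ * v x₁)) := by
    rw [neg_pos]; exact mul_neg_of_pos_of_neg hε0 h2
  linarith

/-! ### The minimum principle of E. Hopf -/

/-- **E. Hopf's minimum principle, local form** (López-Gómez 2012, Thm. 1.2 and Remark 1.1(b)):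
under the hypotheses of `hopf_lt_at_touchingPoint` on the operator `𝔏` and the superharmonic
function `u ≥ m` (`m ≤ 0`) on the open set `Ω`, the set where `u = m` is open: if `u(x⋆) = m` at
`x⋆ ∈ Ω` then `u = m` near `x⋆`. (If `u(y₁) > m` at a point `y₁` close to `x⋆`, the nearest point
`y₂` of the compact set `{u = m} ∩ B̄_R(x⋆)` to `y₁` is a touching point of the ball
`B_{|y₁ - y₂|}(y₁)`, on which `u > m`, contradicting `hopf_lt_at_touchingPoint`.)
[cite: LopezGomez2012, Thm. 1.2 and Remark 1.1(b)] -/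
theorem hopf_minimumPrinciple_eventually_eq {Ω : Set (EuclideanSpace ℝ (Fin N))} (hΩ : IsOpen Ω)
    {a : EuclideanSpace ℝ (Fin N) → Fin N → Fin N → ℝ} {b : EuclideanSpace ℝ (Fin N) → Fin N → ℝ}
    {c u : EuclideanSpace ℝ (Fin N) → ℝ} {μ m : ℝ}
    (ha_symm : ∀ x ∈ Ω, ∀ i j, a x i j = a x j i) (hμ : 0 < μ)
    (hell : ∀ x ∈ Ω, ∀ ξ : EuclideanSpace ℝ (Fin N), μ * ‖ξ‖ ^ 2 ≤ ∑ i, ∑ j, a x i j * ξ i * ξ j)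
    (hbdd : ∀ K ⊆ Ω, IsCompact K →
      ∃ C, ∀ x ∈ K, (∀ i j, |a x i j| ≤ C) ∧ (∀ i, |b x i| ≤ C) ∧ |c x| ≤ C)
    (hc : ∀ x ∈ Ω, 0 ≤ c x) (hu : ContDiffOn ℝ 2 u Ω)
    (hLu : ∀ x ∈ Ω, 0 ≤ -(∑ i, ∑ j, a x i j * fderiv ℝ (fderiv ℝ u) x (EuclideanSpace.single i 1)
        (EuclideanSpace.single j 1)) +
      ∑ i, b x i * fderiv ℝ u x (EuclideanSpace.single i 1) + c x * u x)
    (hm : m ≤ 0) (hum : ∀ x ∈ Ω, m ≤ u x)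
    {x₀ : EuclideanSpace ℝ (Fin N)} (hx₀ : x₀ ∈ Ω) (hux₀ : u x₀ = m) :
    ∀ᶠ x in 𝓝 x₀, u x = m := by
  obtain ⟨R, hR, hRΩ⟩ := nhds_basis_closedBall.mem_iff.mp (hΩ.mem_nhds hx₀)
  set δ : ℝ := R / 3 with hδ
  have hδ0 : 0 < δ := by positivity
  -- the compact piece `Z` of the coincidence set
  set Z : Set (EuclideanSpace ℝ (Fin N)) := closedBall x₀ R ∩ u ⁻¹' {m} with hZ
  have hZc : IsClosed Z :=
    (hu.continuousOn.mono hRΩ).preimage_isClosed_of_isClosed isClosed_closedBall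
      isClosed_singleton
  have hx₀Z : x₀ ∈ Z := ⟨mem_closedBall_self hR.le, hux₀⟩
  -- `u = m` on `B_δ(x₀)`
  suffices h : ∀ y₁ ∈ ball x₀ δ, u y₁ = m from
    Filter.eventually_of_mem (ball_mem_nhds x₀ hδ0) h
  intro y₁ hy₁
  by_contra hne
  obtain ⟨y₂, hy₂Z, hdist⟩ := hZc.exists_infDist_eq_dist ⟨x₀, hx₀Z⟩ y₁
  set ρ : ℝ := dist y₂ y₁ with hρdef
  have hρ' : infDist y₁ Z = ρ := by rw [hdist, dist_comm]
  have hρδ : ρ < δ := by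
    rw [← hρ']
    exact (infDist_le_dist_of_mem hx₀Z).trans_lt (mem_ball.mp hy₁)
  have huy₂ : u y₂ = m := hy₂Z.2
  have hρ0 : 0 < ρ := by
    rw [hρdef, dist_pos]
    rintro rfl
    exact hne huy₂
  have hy₁x₀ : dist y₁ x₀ < δ := mem_ball.mp hy₁
  have hball : ∀ x ∈ ball y₁ ρ, m < u x := by
    intro x hx
    have hx' : dist x y₁ < ρ := mem_ball.mp hx
    have hxR : x ∈ closedBall x₀ R := by
      rw [mem_closedBall]
      linarith [dist_triangle x y₁ x₀]
    refine lt_of_le_of_ne (hum x (hRΩ hxR)) fun hux ↦ ?_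
    have : infDist y₁ Z ≤ dist y₁ x := infDist_le_dist_of_mem ⟨hxR, hux.symm⟩
    rw [hρ', dist_comm] at this
    linarith
  have hK : closedBall y₂ (ρ / 4) ⊆ Ω := by
    intro x hx
    apply hRΩ
    rw [mem_closedBall] at hx ⊢
    linarith [dist_triangle x y₂ x₀, dist_triangle y₂ y₁ x₀]
  have := hopf_lt_at_touchingPoint hΩ ha_symm hμ hell hbdd hc hu hLu hm hum hρ0 rfl hball hK
  exact absurd huy₂ (ne_of_gt this)

/-- **Minimum principle of E. Hopf** (López-Gómez 2012, Thm. 1.2). Let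
`𝔏 = -∑ᵢⱼ aᵢⱼ(x) ∂ᵢⱼ + ∑ᵢ bᵢ(x) ∂ᵢ + c(x)` be uniformly elliptic (`∑ aᵢⱼ ξᵢ ξⱼ ≥ μ|ξ|²`, `μ > 0`,
`aᵢⱼ = aⱼᵢ`) on the open connected set `Ω ⊆ ℝᴺ` with coefficients bounded on compact subsets of
`Ω` ((1.1)–(1.2)) and `c ≥ 0`, and let `u ∈ C²(Ω)` satisfy `𝔏u ≥ 0` in `Ω` and `u ≥ m` in `Ω`
for a constant `m ≤ 0` (in the source `m = inf_Ω u ∈ (-∞, 0]`). Then either `u > m` in `Ω` or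
`u ≡ m` in `Ω`: stated here as — if `u(x₀) = m` for some `x₀ ∈ Ω`, then `u = m` on `Ω`. (The
coincidence set is open by `hopf_minimumPrinciple_eventually_eq`, closed in `Ω` by continuity, and
`Ω` is preconnected.) Partial derivatives are Fréchet derivatives along
`eᵢ = EuclideanSpace.single i 1`. [cite: LopezGomez2012, Thm. 1.2] -/
theorem hopf_minimumPrinciple {Ω : Set (EuclideanSpace ℝ (Fin N))} (hΩ : IsOpen Ω)
    (hconn : IsPreconnected Ω)
    {a : EuclideanSpace ℝ (Fin N) → Fin N → Fin N → ℝ} {b : EuclideanSpace ℝ (Fin N) → Fin N → ℝ}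
    {c u : EuclideanSpace ℝ (Fin N) → ℝ} {μ m : ℝ}
    (ha_symm : ∀ x ∈ Ω, ∀ i j, a x i j = a x j i) (hμ : 0 < μ)
    (hell : ∀ x ∈ Ω, ∀ ξ : EuclideanSpace ℝ (Fin N), μ * ‖ξ‖ ^ 2 ≤ ∑ i, ∑ j, a x i j * ξ i * ξ j)
    (hbdd : ∀ K ⊆ Ω, IsCompact K →
      ∃ C, ∀ x ∈ K, (∀ i j, |a x i j| ≤ C) ∧ (∀ i, |b x i| ≤ C) ∧ |c x| ≤ C)
    (hc : ∀ x ∈ Ω, 0 ≤ c x) (hu : ContDiffOn ℝ 2 u Ω)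
    (hLu : ∀ x ∈ Ω, 0 ≤ -(∑ i, ∑ j, a x i j * fderiv ℝ (fderiv ℝ u) x (EuclideanSpace.single i 1)
        (EuclideanSpace.single j 1)) +
      ∑ i, b x i * fderiv ℝ u x (EuclideanSpace.single i 1) + c x * u x)
    (hm : m ≤ 0) (hum : ∀ x ∈ Ω, m ≤ u x)
    {x₀ : EuclideanSpace ℝ (Fin N)} (hx₀ : x₀ ∈ Ω) (hux₀ : u x₀ = m) :
    ∀ x ∈ Ω, u x = m := by
  set U₁ : Set (EuclideanSpace ℝ (Fin N)) := {x | ∀ᶠ y in 𝓝 x, u y = m} with hU₁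
  set U₂ : Set (EuclideanSpace ℝ (Fin N)) := Ω ∩ u ⁻¹' {m}ᶜ with hU₂
  have hU₁o : IsOpen U₁ := isOpen_setOf_eventually_nhds
  have hU₂o : IsOpen U₂ := hu.continuousOn.isOpen_inter_preimage hΩ isOpen_compl_singleton
  have hdisj : Disjoint U₁ U₂ := by
    rw [Set.disjoint_left]
    rintro x hx₁ ⟨-, hx₂⟩
    exact hx₂ (show ∀ᶠ y in 𝓝 x, u y = m from hx₁).self_of_nhds
  have hcover : Ω ⊆ U₁ ∪ U₂ := fun x hx ↦ by
    by_cases hux : u x = m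
    · exact Or.inl (hopf_minimumPrinciple_eventually_eq hΩ ha_symm hμ hell hbdd hc hu hLu hm hum
        hx hux)
    · exact Or.inr ⟨hx, hux⟩
  rcases hconn.subset_or_subset hU₁o hU₂o hdisj hcover with h | h
  · exact fun x hx ↦ (show ∀ᶠ y in 𝓝 x, u y = m from h hx).self_of_nhds
  · exact absurd hux₀ (h hx₀).2

end Literature.Analysis.PDE

end
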